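import Summits.AtomisticToContinuum.Crystallization.Theorems.FrustrationRangeCertificatesPatternPricedCertificatesBridgeCorollary
import Summits.AtomisticToContinuum.Crystallization.Theorems.FrustrationRangeCertificatesPatternPricedCertificatesHcpUnique

/-!
# Crux `PatternPricedCertificates` (stmt-AtomisticToContinuum-12974), line `registered`: the end state of the line

`PatternPricedCertificates` from the box-local unique-minimiser statement for the Lennard-Jones hcp family (stub B5', certified numerics) and
`PalmRigidity` (stmt-AtomisticToContinuum-9224, the open target of route `PalmUnimodularRigidity`). Every other ingredient of the line is a
theorem of the tree. `[folklore]`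
-/

noncomputable section

namespace Summit.AtomisticToContinuum.Crystallization.Theorems.PatternPricedCertificates

/-- **The crux from the unique hcp minimiser and the σ-additive Palm rigidity** (conditional result, the end state of line `registered`):
`(B5': the LJ hcp family has a unique minimiser on [1/2,2]²) → PalmRigidity (stmt-AtomisticToContinuum-9224) → PatternPricedCertificates`.
[folklore] -/
theorem patternPricedCertificates_of_uniqueMinimiser_of_palmRigidity :
    (∃ (a₀ h₀ : ℝ) (ha₀ : a₀ ≠ 0) (hh₀ : h₀ ≠ 0), 1 / 2 ≤ a₀ ∧ a₀ ≤ 2 ∧ 1 / 2 ≤ h₀ ∧ h₀ ≤ 2 ∧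
      ∀ (a h : ℝ) (ha : a ≠ 0) (hh : h ≠ 0), 1 / 2 ≤ a → a ≤ 2 → 1 / 2 ≤ h → h ≤ 2 →
        (Literature.MathematicalPhysics.StatisticalMechanics.hcpPeriodicConfiguration ha hh).energyPerParticle Literature.MathematicalPhysics.StatisticalMechanics.lennardJones ≤
          (Literature.MathematicalPhysics.StatisticalMechanics.hcpPeriodicConfiguration ha₀ hh₀).energyPerParticle Literature.MathematicalPhysics.StatisticalMechanics.lennardJones →
        a = a₀ ∧ h = h₀) →
    Summit.AtomisticToContinuum.Crystallization.Theses.PalmUnimodularRigidity.PalmRigidity →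
    Summit.AtomisticToContinuum.Crystallization.Theses.FrustrationRangeCertificates.PatternPricedCertificates :=
  fun hU => patternPricedCertificates_of_hcpUnique_of_palmRigidity (hcpUnique_of_uniqueMinimiser hU)

end Summit.AtomisticToContinuum.Crystallization.Theorems.PatternPricedCertificates

end
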